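import Summits.Ventures.PackingBounds.ThreePointCert.C6TCert

/-!
# A(6, arccos 1/3) ≤ 35 (three-point bound, kernel-checked): kernel validation of Gram block R3 (chunks 1–1 of 1)

Framing: lottery ticket; floor = certified bounds/negative ranges. Venture `PackingBounds` (cell
`pub-packcert`), three-point SDP family. Integer data of a feasible point of the Bachoc–Vallentin
semidefinite program (n = 6, s = 1/3, degree d = 8, symmetric
sums of squares), derived by `pub-packcert-sdp/code/cert2lean.py` from the exact rational
certificate `sdp-n6-d8-s1-3-sym.json` of the cell (two independent exact verifiers + referee), in the
units of the kernel checker `ThreePointCert.Check` (soundness `ThreePointCert.Sound`). Generated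
file: plain lists of integers / monomials.
-/

namespace Summit.Ventures.PackingBounds.ThreePointCert.C6T

open Literature.Geometry.DiscreteGeometry Literature.Geometry.DiscreteGeometry.PolyCert PolyCert.SPoly

set_option maxHeartbeats 0 in
/-- Block `R3`: rows from 0 ((gR3.z.length - 0) rows) of `zᵀ(LLᵀ)z` added to `[]` give `eR3` (kernel). -/
theorem okR3_1 : chunkOK C6T.gR3 0 (C6T.gR3.z.length - 0) [] C6T.eR3 = true := by
  decide +kernel

end Summit.Ventures.PackingBounds.ThreePointCert.C6T
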